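import Summits.KontsevichZagierPeriods.Zeta5Search.LaiSweepShard

/-!
# `κ₃` sweep certificate — shard file 022 of 127 (shards 154–160 of 889)

HONEST FRAMING. Systematic search; no irrationality claim unless certified. This file only checks,
by `decide +kernel`, shards 154–160 of the order-cell sweep of the `κ₃` point `(74, 2180, 444; δ74)`
(engine `LaiSweepEngine`, soundness `LaiSweepJump/Free/Eval/Shard/Kappa3`; a shard is `⟨regime, n,
p, q, p', q', Lo, Up⟩`: `n` cells from `p/q` to `p'/q'` with integer rate sums in `[Lo, Up]`, `K =
128`, `D = 2^40`). It draws NO conclusion: only the capstone `LaiKappa3SweepCert`, which needs all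
127 shard files, does. Kernel cost of this file ≈ 560 cells × 0.3 s.
-/

namespace Summit.KontsevichZagierPeriods.Zeta5Search.Sweep

set_option maxHeartbeats 100000000 in
/-- Shard 154: 80 cells of regime B from `21/278` to `26/339`.
[cite: Lai2024BallRivoal, §4 Lemma 4.3] -/
theorem shard154 :
    Shard.check 128 (2^40)
      ⟨true, 80, 21, 278, 26, 339, 80273510812486, 80535809246421⟩ = true := by
  decide +kernel

set_option maxHeartbeats 100000000 in
/-- Shard 155: 80 cells of regime B from `26/339` to `375/4804`.
[cite: Lai2024BallRivoal, §4 Lemma 4.3] -/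
theorem shard155 :
    Shard.check 128 (2^40)
      ⟨true, 80, 26, 339, 375, 4804, 92715955180158, 93052269927760⟩ = true := by
  decide +kernel

set_option maxHeartbeats 100000000 in
/-- Shard 156: 80 cells of regime B from `375/4804` to `381/4804`.
[cite: Lai2024BallRivoal, §4 Lemma 4.3] -/
theorem shard156 :
    Shard.check 128 (2^40)
      ⟨true, 80, 375, 4804, 381, 4804, 83644253272129, 83942946182726⟩ = true := by
  decide +kernel

set_option maxHeartbeats 100000000 in
/-- Shard 157: 80 cells of regime B from `381/4804` to `29/360`.
[cite: Lai2024BallRivoal, §4 Lemma 4.3] -/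
theorem shard157 :
    Shard.check 128 (2^40)
      ⟨true, 80, 381, 4804, 29, 360, 81756157724309, 82060092400324⟩ = true := by
  decide +kernel

set_option maxHeartbeats 100000000 in
/-- Shard 158: 80 cells of regime B from `29/360` to `393/4804`.
[cite: Lai2024BallRivoal, §4 Lemma 4.3] -/
theorem shard158 :
    Shard.check 128 (2^40)
      ⟨true, 80, 29, 360, 393, 4804, 81408542602057, 81718756702053⟩ = true := by
  decide +kernel

set_option maxHeartbeats 100000000 in
/-- Shard 159: 80 cells of regime B from `393/4804` to `23/277`.
[cite: Lai2024BallRivoal, §4 Lemma 4.3] -/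
theorem shard159 :
    Shard.check 128 (2^40)
      ⟨true, 80, 393, 4804, 23, 277, 77652830284054, 77953167165948⟩ = true := by
  decide +kernel

set_option maxHeartbeats 100000000 in
/-- Shard 160: 80 cells of regime B from `23/277` to `20/237`.
[cite: Lai2024BallRivoal, §4 Lemma 4.3] -/
theorem shard160 :
    Shard.check 128 (2^40)
      ⟨true, 80, 23, 277, 20, 237, 84865802948483, 85228957727918⟩ = true := by
  decide +kernel

/-- The checked shards of this file, in order. [folklore] -/
def shards022 : List (CheckedShard 128 (2^40)) :=
  [⟨_, shard154⟩, ⟨_, shard155⟩, ⟨_, shard156⟩, ⟨_, shard157⟩, ⟨_, shard158⟩,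
    ⟨_, shard159⟩, ⟨_, shard160⟩]

end Summit.KontsevichZagierPeriods.Zeta5Search.Sweep
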